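import Summits.KontsevichZagierPeriods.KontsevichZagierPeriods.Theses.K2SymbolChains
import Summits.KontsevichZagierPeriods.KontsevichZagierPeriods.Theorems.K2SymbolChainsFigureEightIsTwoSmythDoubling
import Summits.KontsevichZagierPeriods.KontsevichZagierPeriods.Theorems.K2SymbolChainsClausenPiVanishesAtoms

/-!
# `FigureEightIsTwoSmyth`: the Jensen step on the Smyth side (helper, conditional on `JensenMove`)

Item stmt-KontsevichZagierPeriods-5203 of route K2SymbolChains. The doubled unfolded torus
representation `r_B` of `M(1+x+y)` (domain `{u between 1 and |1 + e(t) + e(s)|²}`, integrand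
`±4/((1+t²)(1+s²)u)`) is, fibrewise over `t`, the unfolded Jensen integral of
`log |e(s) − α(t)|²` with centre `α(t) = −(1 + e(t))`, `|α(t)|² = 4/(1+t²)`. ONE instance of the
route's crux `JensenMove` (item stmt-5199, taken here as a hypothesis) replaces it by the band
representation

  `R_B = [{−√3 < t < √3, 1 < u < 4/(1+t²)}, 4/((1+t²)(1+s²)u)]`

(`exists_smythBand_of_jensenMove`: `[r_B] − [R_B] ∈ KZ.relations`; value `π ∫ 4 log⁺(4/(1+t²)) dt/(1+t²)`
`= 8π² m(1+x+y)`). The Jensen hypotheses are discharged from the absolute convergence of the Clausen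
integrand (`ClausenPi.integrable_h_mul_log_W`); `R_B` is built with `exists_bandRep`.
[Kontsevich–Zagier 2001, §1.1–1.2; Smyth 1981; folklore]
-/

noncomputable section

open MeasureTheory Set
open Literature.NumberTheory.Transcendental Literature.ModelTheory.ExponentialFields
open Summit.KontsevichZagierPeriods.K2SymbolChains.JensenIsScissorsProof

-- single-conjunct summit: Sub = Summit, so the namespace segment repeats by design (CONVENTIONS §2)
set_option linter.dupNamespace false

namespace Summit.KontsevichZagierPeriods.KontsevichZagierPeriods.Theorems

open Literature.NumberTheory.Transcendental.KZ

/-- `|α(t)|² = (1 + c(t))² + σ(t)² = 4/(1+t²)` for the Jensen centre `α = −(1 + e(t))` of `1 + x + y`.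
[Smyth 1981; folklore] -/
theorem smyth_centre_normSq (t : ℝ) :
    (-(1 + (1 - t ^ 2) / (1 + t ^ 2))) ^ 2 + (-(2 * t / (1 + t ^ 2))) ^ 2 = 4 / (1 + t ^ 2) := by
  have h : (1 + t ^ 2 : ℝ) ≠ 0 := by positivity
  field_simp
  ring

/-- The item's fibre bound is the Jensen fibre bound: `|e(s) − α(t)|² = |1 + e(t) + e(s)|²`. [folklore] -/
theorem smyth_bound_eq (t s : ℝ) :
    ((1 - s ^ 2) / (1 + s ^ 2) - -(1 + (1 - t ^ 2) / (1 + t ^ 2))) ^ 2 +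
        (2 * s / (1 + s ^ 2) - -(2 * t / (1 + t ^ 2))) ^ 2 =
      (1 + (1 - t ^ 2) / (1 + t ^ 2) + (1 - s ^ 2) / (1 + s ^ 2)) ^ 2 +
        (2 * t / (1 + t ^ 2) + 2 * s / (1 + s ^ 2)) ^ 2 := by
  ring

/-- `1 < 4/(1+t²) ↔ −√3 < t < √3`. [folklore] -/
theorem one_lt_four_div_iff (t : ℝ) : 1 < 4 / (1 + t ^ 2) ↔ t ∈ Ioo (-Real.sqrt 3) (Real.sqrt 3) := by
  have h : (0 : ℝ) < 1 + t ^ 2 := by positivity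
  rw [lt_div_iff₀ h, one_mul, mem_Ioo, ← abs_lt, ← sq_abs]
  constructor
  · intro h1
    exact (Real.lt_sqrt (abs_nonneg t)).2 (by linarith)
  · intro h1
    have := (Real.lt_sqrt (abs_nonneg t)).1 h1
    linarith

/-- **The Jensen step on the Smyth side.** Assuming the route's crux `JensenMove`, the doubled
unfolded torus representation `r_B` of `M(1+x+y)` (the item's `r'`) is KZ-equivalent to the band
representation `R_B = [{−√3 < t < √3, 1 < u < 4/(1+t²)}, 4/((1+t²)(1+s²)u)]`, which exists.
[Kontsevich–Zagier 2001, §1.2; Smyth 1981; folklore] -/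
theorem exists_smythBand_of_jensenMove (hJ : Theses.K2SymbolChains.JensenMove) (rB : IntegralRep 3)
    (hrBd : rB.domain = {w | (1 < w 2 ∧ w 2 < ((1 + (1 - w 0 ^ 2) / (1 + w 0 ^ 2) +
        (1 - w 1 ^ 2) / (1 + w 1 ^ 2)) ^ 2 + (2 * w 0 / (1 + w 0 ^ 2) + 2 * w 1 / (1 + w 1 ^ 2)) ^ 2)) ∨
        (((1 + (1 - w 0 ^ 2) / (1 + w 0 ^ 2) + (1 - w 1 ^ 2) / (1 + w 1 ^ 2)) ^ 2 +
        (2 * w 0 / (1 + w 0 ^ 2) + 2 * w 1 / (1 + w 1 ^ 2)) ^ 2) < w 2 ∧ w 2 < 1)})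
    (hrBi : EqOn rB.integrand (fun w => (if 1 < w 2 then (1:ℝ) else -1) * 4 /
        ((1 + w 0 ^ 2) * (1 + w 1 ^ 2) * w 2)) rB.domain) :
    ∃ RB : IntegralRep 3, RB.domain = {z : Fin 3 → ℝ | Fin.init z ∈ {b : Fin 2 → ℝ | b 0 ∈ Ioo (-Real.sqrt 3) (Real.sqrt 3)} ∧
      1 < z (Fin.last 2) ∧ z (Fin.last 2) < 4 / (1 + (Fin.init z) 0 ^ 2)} ∧
      RB.integrand = (fun z => 4 / ((1 + (Fin.init z) 0 ^ 2) * (1 + (Fin.init z) 1 ^ 2)) / z (Fin.last 2)) ∧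
      of rB - of RB ∈ relations := by
  -- the band representation `R_B`
  set T : Set (Fin 2 → ℝ) := {b : Fin 2 → ℝ | b 0 ∈ Ioo (-Real.sqrt 3) (Real.sqrt 3)} with hT_def
  have hT : IsSemialgebraic ℚ T := isSemialgebraic_window
  set G : (Fin 2 → ℝ) → ℝ := fun b => 4 / ((1 + b 0 ^ 2) * (1 + b 1 ^ 2)) with hG
  set V : (Fin 2 → ℝ) → ℝ := fun b => 4 / (1 + b 0 ^ 2) with hV
  have hGs : IsSemialgebraicFunOn ℚ T G := by simpa [hG] using isSemialgebraicFunOn_weight hT 4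
  have hVs : IsSemialgebraicFunOn ℚ T V :=
    (isSemialgebraicFunOn_aeval_div_aeval hT (MvPolynomial.C 4) (1 + MvPolynomial.X 0 ^ 2) fun b _ => by
      have : (0 : ℝ) < 1 + b 0 ^ 2 := by positivity
      simpa using this.ne').congr fun b _ => by simp [hV]
  have hc1 : IsSemialgebraicFunOn ℚ T (fun _ => (1 : ℝ)) := by simpa using isSemialgebraicFunOn_ratCast hT 1
  have hV1 : ∀ b ∈ T, 1 ≤ V b := fun b hb => ((one_lt_four_div_iff (b 0)).2 hb).le
  have hne1 : ∀ x : ℝ, (1 + x ^ 2 : ℝ) ≠ 0 := fun x => by positivity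
  have hc1x : Continuous fun x : ℝ => (1 + x ^ 2 : ℝ) := continuous_const.add (continuous_pow 2)
  have hk : ContinuousOn (fun x : ℝ => 4 / (1 + x ^ 2) * Real.log (4 / (1 + x ^ 2))) (Icc (-Real.sqrt 3) (Real.sqrt 3)) := by
    refine ((continuous_const.div hc1x hne1).mul (Continuous.log (continuous_const.div hc1x hne1) fun x => ?_)).continuousOn
    have : (0 : ℝ) < 4 / (1 + x ^ 2) := by positivity
    exact this.ne'
  have hGV : IntegrableOn (fun b => G b * Real.log (V b)) T := by
    refine (integrableOn_window_mul hk).congr_fun (fun b _ => ?_) (IsSemialgebraic.measurableSet_holds hT)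
    simp only [hG, hV]
    have h1 : (1 + b 1 ^ 2 : ℝ) ≠ 0 := by positivity
    have h0 : (1 + b 0 ^ 2 : ℝ) ≠ 0 := by positivity
    set L := Real.log (4 / (1 + b 0 ^ 2)) with hL
    clear_value L
    field_simp
  have hG1 : IntegrableOn (fun b => G b * Real.log ((fun _ : Fin 2 → ℝ => (1 : ℝ)) b)) T := by simp
  obtain ⟨RB, hRBd, hRBi⟩ := exists_bandRep (a := fun _ => (1 : ℝ)) (b := V) hT hGs hc1 hVs (fun _ _ => one_pos)
    hV1 hG1 hGV
  -- coordinates of the Jensen statement at `n = 1`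
  have e0 : ∀ w : Fin 3 → ℝ, (fun i : Fin 1 => w (Fin.castAdd 2 i)) 0 = w 0 := fun w => rfl
  have e1 : ∀ w : Fin 3 → ℝ, w (Fin.natAdd 1 (0 : Fin 2)) = w 1 := fun w => rfl
  have e2 : ∀ w : Fin 3 → ℝ, w (Fin.natAdd 1 (1 : Fin 2)) = w 2 := fun w => rfl
  have i0 : ∀ z : Fin 3 → ℝ, (Fin.init z) 0 = z 0 := fun z => rfl
  have i1 : ∀ z : Fin 3 → ℝ, (Fin.init z) 1 = z 1 := fun z => rfl
  have l2 : ∀ z : Fin 3 → ℝ, z (Fin.last 2) = z 2 := fun z => rfl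
  refine ⟨RB, hRBd, hRBi, hJ 1 univ (fun x => 4 / (1 + x 0 ^ 2)) (fun x => -(1 + (1 - x 0 ^ 2) / (1 + x 0 ^ 2)))
    (fun x => -(2 * x 0 / (1 + x 0 ^ 2))) rB RB isSemialgebraic_univ ?_ ?_ ?_ ?_ ?_ ?_ ?_ ?_⟩
  · refine (isSemialgebraicFunOn_aeval_div_aeval isSemialgebraic_univ (MvPolynomial.C 4) (1 + MvPolynomial.X 0 ^ 2)
      fun x _ => ?_).congr fun x _ => by simp
    simpa using hne1 (x 0)
  · refine (isSemialgebraicFunOn_aeval_div_aeval isSemialgebraic_univ (-(2 : MvPolynomial (Fin 1) ℚ))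
      (1 + MvPolynomial.X 0 ^ 2) fun x _ => ?_).congr fun x _ => ?_
    · simpa using hne1 (x 0)
    · have h := hne1 (x 0)
      simp only [map_neg, map_add, map_one, map_pow, MvPolynomial.aeval_X, map_ofNat]
      field_simp
      ring
  · refine (isSemialgebraicFunOn_aeval_div_aeval isSemialgebraic_univ (-(2 * MvPolynomial.X 0))
      (1 + MvPolynomial.X 0 ^ 2) fun x _ => ?_).congr fun x _ => ?_
    · simpa using hne1 (x 0)
    · simp [neg_div]
  · -- integrability of `h (1 + |log |α|²|)` on `ℝ¹`
    have hI := (Summit.KontsevichZagierPeriods.K2SymbolChains.ClausenPi.integrable_h.const_mul 4).add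
      ((Summit.KontsevichZagierPeriods.K2SymbolChains.ClausenPi.integrable_h_mul_log_W.abs).const_mul 4)
    refine (hI.integrableOn (s := univ)).congr_fun (fun x _ => ?_) MeasurableSet.univ
    rw [smyth_centre_normSq]
    simp only [Pi.add_apply]
    have hpos : (0 : ℝ) < 1 / (1 + x 0 ^ 2) := by positivity
    rw [abs_mul, abs_of_pos hpos]
    ring
  · rw [hrBd]
    ext w
    simp only [mem_setOf_eq, mem_univ, true_and, e0, e1, e2, smyth_bound_eq]
  · intro w hw
    rw [hrBi hw]
    simp only [e0, e1, e2]
    have hw' := hw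
    rw [hrBd] at hw'
    have hw2 : w 2 ≠ 0 := by
      rcases hw' with ⟨h1, -⟩ | ⟨h1, -⟩
      · exact (one_pos.trans h1).ne'
      · exact ((by positivity : (0:ℝ) ≤ _).trans_lt h1).ne'
    have h0 := hne1 (w 0)
    have h1 := hne1 (w 1)
    field_simp
  · rw [hRBd]
    ext w
    simp only [mem_setOf_eq, mem_univ, true_and, e0, e2, smyth_centre_normSq, hT_def, hV, i0, l2,
      ← one_lt_four_div_iff]
    constructor
    · rintro ⟨-, h1, h2⟩; exact ⟨h1, h2⟩
    · rintro ⟨h1, h2⟩; exact ⟨h1.trans h2, h1, h2⟩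
  · intro w hw
    rw [hRBi]
    simp only [e0, e1, e2, hG, i0, i1, l2]
    have h0 := hne1 (w 0)
    have h1 := hne1 (w 1)
    field_simp

end Summit.KontsevichZagierPeriods.KontsevichZagierPeriods.Theorems
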